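import Summits.RiemannHypothesis.RiemannHypothesis.Theorems.HandoffPoleFreePairing
import Summits.RiemannHypothesis.RiemannHypothesis.Theorems.MotivicDoorSemilocalClosed
import Literature.NumberTheory.ConnesConsani2021.WeilPropertyP
import HarnessLib

/-!
# HANDOFF — the POLE-FREE positive windows are CLOSED: Conj. 4.1's open window = Connes's `P(q)`
# (cell rh-explicit, TRACK «HANDOFF», seat theory-1, file XV)

HONEST FRAMING. Nothing here bears on the truth of RH. This is an unconditional structural fact about Weil's quadratic
form `Q(g) = W(g ⋆ g̃)` (`WeilExplicit.lean`) on the POLE-FREE class `ĝ(0) = ĝ(1) = 0` (Connes–Consani's two vanishing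
conditions), settling the point recorded OPEN in HANDOFF-STATEMENT §J.18 (3)(ii).

THE STATEMENT (`poleFree_nonneg_Icc_of_Ioo`). Fix `a > 0`. If `0 ≤ Re Q(g)` for every pole-free test function supported
in the OPEN window `(−a, a)`, then `0 ≤ Re Q(g)` for every pole-free test function supported in the CLOSED window
`[−a, a]`. COROLLARY (`cc41_iff_weilPropertyP`): the content of Connes–Consani's Conjecture 4.1 at the parameter `q`
(«The scaling Hamiltonian», J. Operator Theory 85 (2021) = arXiv:1910.14368, Conj. 4.1 p. 18: pole-free test
functions supported in the OPEN interval `(q^{−1/2}, q^{1/2})`) is EXACTLY Connes's property `P(q)` (Connes 2026 §4.1,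
tree `weilPropertyP q`: pole-free test functions supported in the CLOSED interval): `CC41((log q)/2) ↔ P(q)`.

WHY IT IS NOT THE FULL-CLASS ARGUMENT VERBATIM. For the full class `C(a)` closedness of the positive windows is in the
tree (`weilSemilocalPositivityOn_of_forall_lt`, Yoshida's Lemma-7 step via Bombieri's unitary dilation `g_η`,
`weilDilate`): `g_η ∈ C(a/(1+η))` and `η ↦ Q(g_η)` is continuous. But the dilation does NOT preserve the two vanishing
conditions: `(g_η)^(s) = (1+η)^{−1/2} ĝ(½ + (s−½)/(1+η))` (`weilMellin_weilDilate`), so `(g_η)^(0)`, `(g_η)^(1)` are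
values of `ĝ` at `½ ∓ 1/(2(1+η))`, not at `0, 1`. THE REPAIR (this file): correct the dilate inside a fixed
two-dimensional family — `h_η := (g − c₁(η) φ − c₂(η) φ′)_η` with `φ` a non-negative bump in `C(a)` (`φ̂` has positive
real part on the real axis, so the 2×2 system is solvable for EVERY `η > −1`, by Cramer) — so that `h_η` is pole-free,
supported in `(−a, a)` for `η > 0`, and `η ↦ Q(h_η)` is continuous at `0` with `h_0 = g` (the coefficients `c_j(η)` are
continuous and vanish at `η = 0` because `ĝ(0) = ĝ(1) = 0`; `Q` of the corrected dilate is a finite sesquilinear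
expansion in pairings `W(u_η ⋆ ṽ_η) = W((u ⋆ ṽ)((1+η)·))`, each continuous by the tree's rescaling variation
`hasDerivAt_weilFunctional_comp_mul`).

References: A. Connes, C. Consani, *The scaling Hamiltonian*, J. Operator Theory 85 (2021) 259–278, Conj. 4.1
[`ConnesConsani2021ScalingHamiltonian`]; A. Connes (2026) §4.1 [`Connes2026Letter`]; E. Bombieri, Rend. Lincei (9) 11
(2000) §4 (the dilation) [`Bombieri2000Weil`]; H. Yoshida, Adv. Stud. Pure Math. 21 (1992) Lemma 7 / Prop. 6
[`Yoshida1992HermitianForms`].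
-/

set_option linter.dupNamespace false  -- the mandated namespace repeats `RiemannHypothesis`

noncomputable section

open Set Filter Complex MeasureTheory Literature.NumberTheory.LFunctions Literature.NumberTheory.ConnesConsani2021
open Summit.RiemannHypothesis.RiemannHypothesis.Theorems.PfPersistenceM2NegIndex
open Summit.RiemannHypothesis.RiemannHypothesis.Theorems.MotivicDoor.Semilocal
open scoped Topology ComplexConjugate

namespace Summit.RiemannHypothesis.RiemannHypothesis.Theorems.HandoffPoleFree

variable {u u' v v' g : ℝ → ℂ} {a η : ℝ}

/-! ## §4  The corrected dilate and the closedness theorem -/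

/-- The moving Mellin points `s₀(η) = ½ − 1/(2(1+η))`, `s₁(η) = ½ + 1/(2(1+η))` are REAL. [folklore] -/
theorem dilateArg_zero_eq {η : ℝ} (hη : -1 < η) :
    (1 / 2 : ℂ) + ((0 : ℂ) - 1 / 2) / ((1 + η : ℝ) : ℂ) = ((1 / 2 - 1 / (2 * (1 + η)) : ℝ) : ℂ) := by
  have hc : ((1 + η : ℝ) : ℂ) ≠ 0 := by exact_mod_cast (show (1 + η : ℝ) ≠ 0 by linarith)
  push_cast at hc ⊢
  field_simp
  ring

/-- Companion of `dilateArg_zero_eq` at `s = 1`. [folklore] -/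
theorem dilateArg_one_eq {η : ℝ} (hη : -1 < η) :
    (1 / 2 : ℂ) + ((1 : ℂ) - 1 / 2) / ((1 + η : ℝ) : ℂ) = ((1 / 2 + 1 / (2 * (1 + η)) : ℝ) : ℂ) := by
  have hc : ((1 + η : ℝ) : ℂ) ≠ 0 := by exact_mod_cast (show (1 + η : ℝ) ≠ 0 by linarith)
  push_cast at hc ⊢
  field_simp
  ring

/-- **CLOSEDNESS OF THE POLE-FREE POSITIVE WINDOWS.** If `0 ≤ Re Q(g)` for every pole-free test function
(`ĝ(0) = ĝ(1) = 0`) supported in the OPEN window `(−a, a)`, then the same holds for every pole-free test function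
supported in the CLOSED window `[−a, a]` (`a > 0`). Proof: the corrected dilates `h_η = (g − c₁(η)φ − c₂(η)φ′)_η`,
`η ↓ 0`, are pole-free, live in the open window, and `Q(h_η) → Q(g)`. [cite: Yoshida1992HermitianForms, Lemma 7 (p. 312) / Prop. 6 (p. 320) (the full-class step, transposed to the pole-free class); Bombieri2000Weil §4 (the dilation)] -/
theorem poleFree_nonneg_Icc_of_Ioo (ha : 0 < a)
    (h : ∀ g : ℝ → ℂ, IsWeilTest g → tsupport g ⊆ Ioo (-a) a → weilMellin g 0 = 0 → weilMellin g 1 = 0 →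
      0 ≤ (weilQuadratic g).re) :
    ∀ g : ℝ → ℂ, IsWeilTest g → tsupport g ⊆ Icc (-a) a → weilMellin g 0 = 0 → weilMellin g 1 = 0 →
      0 ≤ (weilQuadratic g).re := by
  intro g hg hsupp hg0 hg1
  obtain ⟨φ, hφ, hφsupp, hφpos⟩ := exists_isWeilTest_tsupport_subset_re_weilMellin_pos ha
  set ψ : ℝ → ℂ := deriv φ with hψ_def
  have hψ : IsWeilTest ψ := hφ.deriv
  have hψsupp : tsupport ψ ⊆ Icc (-a) a :=
    (closure_minimal (support_deriv_subset (f := φ)) (isClosed_tsupport φ)).trans hφsupp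
  -- the moving points and the transforms there
  set s₀ : ℝ → ℂ := fun η ↦ (1 / 2 : ℂ) + ((0 : ℂ) - 1 / 2) / ((1 + η : ℝ) : ℂ) with hs₀
  set s₁ : ℝ → ℂ := fun η ↦ (1 / 2 : ℂ) + ((1 : ℂ) - 1 / 2) / ((1 + η : ℝ) : ℂ) with hs₁
  set G₀ : ℝ → ℂ := fun η ↦ weilMellin g (s₀ η) with hG₀
  set G₁ : ℝ → ℂ := fun η ↦ weilMellin g (s₁ η) with hG₁
  set P₀ : ℝ → ℂ := fun η ↦ weilMellin φ (s₀ η) with hP₀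
  set P₁ : ℝ → ℂ := fun η ↦ weilMellin φ (s₁ η) with hP₁
  -- `ψ̂(s) = −(s − ½) φ̂(s)`
  have hψM : ∀ s : ℂ, weilMellin ψ s = -(s - 1 / 2) * weilMellin φ s := fun s ↦ weilMellin_deriv hφ s
  -- the determinant `φ̂(s₀)ψ̂(s₁) − ψ̂(s₀)φ̂(s₁) = φ̂(s₀)φ̂(s₁)(s₀ − s₁)` never vanishes (η > −1)
  set D : ℝ → ℂ := fun η ↦ P₀ η * weilMellin ψ (s₁ η) - weilMellin ψ (s₀ η) * P₁ η with hD
  have hDeq : ∀ η, D η = P₀ η * P₁ η * (s₀ η - s₁ η) := by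
    intro η
    simp only [hD, hP₀, hP₁, hψM]
    ring
  have hP₀ne : ∀ η : ℝ, -1 < η → P₀ η ≠ 0 := by
    intro η hη hz
    have := hφpos (1 / 2 - 1 / (2 * (1 + η)))
    rw [← dilateArg_zero_eq hη] at this
    change 0 < (P₀ η).re at this
    rw [hz] at this
    simp at this
  have hP₁ne : ∀ η : ℝ, -1 < η → P₁ η ≠ 0 := by
    intro η hη hz
    have := hφpos (1 / 2 + 1 / (2 * (1 + η)))
    rw [← dilateArg_one_eq hη] at this
    change 0 < (P₁ η).re at this
    rw [hz] at this
    simp at this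
  have hs₀₁ : ∀ η : ℝ, -1 < η → s₀ η - s₁ η ≠ 0 := by
    intro η hη
    have hc : ((1 + η : ℝ) : ℂ) ≠ 0 := by
      exact_mod_cast (show (1 + η : ℝ) ≠ 0 by linarith)
    have e : s₀ η - s₁ η = -1 / ((1 + η : ℝ) : ℂ) := by
      simp only [hs₀, hs₁]
      ring
    rw [e]
    exact div_ne_zero (by norm_num) hc
  have hDne : ∀ η : ℝ, -1 < η → D η ≠ 0 := by
    intro η hη
    rw [hDeq]
    exact mul_ne_zero (mul_ne_zero (hP₀ne η hη) (hP₁ne η hη)) (hs₀₁ η hη)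
  -- Cramer coefficients
  set c₁ : ℝ → ℂ := fun η ↦ (G₀ η * weilMellin ψ (s₁ η) - weilMellin ψ (s₀ η) * G₁ η) / D η with hc₁
  set c₂ : ℝ → ℂ := fun η ↦ (P₀ η * G₁ η - G₀ η * P₁ η) / D η with hc₂
  have hCramer₀ : ∀ η : ℝ, -1 < η → c₁ η * P₀ η + c₂ η * weilMellin ψ (s₀ η) = G₀ η := by
    intro η hη
    have hD' := hDne η hη
    simp only [hc₁, hc₂]
    field_simp
    simp only [hD]
    ring
  have hCramer₁ : ∀ η : ℝ, -1 < η → c₁ η * P₁ η + c₂ η * weilMellin ψ (s₁ η) = G₁ η := by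
    intro η hη
    have hD' := hDne η hη
    simp only [hc₁, hc₂]
    field_simp
    simp only [hD]
    ring
  -- the corrected function and its dilate
  set F : ℝ → (ℝ → ℂ) := fun η ↦ g + (fun t ↦ (-c₁ η) * φ t) + fun t ↦ (-c₂ η) * ψ t with hF
  have hFtest : ∀ η, IsWeilTest (F η) := fun η ↦ (hg.add (hφ.const_mul _)).add (hψ.const_mul _)
  have hFsupp : ∀ η, tsupport (F η) ⊆ Icc (-a) a := by
    intro η
    refine (tsupport_add _ _).trans (union_subset ((tsupport_add _ _).trans (union_subset hsupp ?_)) ?_)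
    · exact (tsupport_mul_subset_right (f := fun _ : ℝ ↦ -c₁ η) (g := φ)).trans hφsupp
    · exact (tsupport_mul_subset_right (f := fun _ : ℝ ↦ -c₂ η) (g := ψ)).trans hψsupp
  have hFM : ∀ η (s : ℂ), weilMellin (F η) s = weilMellin g s + (-c₁ η) * weilMellin φ s + (-c₂ η) * weilMellin ψ s := by
    intro η s
    have h1 : IsWeilTest (fun t ↦ (-c₁ η) * φ t) := hφ.const_mul _
    have h2 : IsWeilTest (fun t ↦ (-c₂ η) * ψ t) := hψ.const_mul _
    simp only [hF]
    rw [weilMellin_add (hg.add h1).1.continuous (hg.add h1).2 h2.1.continuous h2.2,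
      weilMellin_add hg.1.continuous hg.2 h1.1.continuous h1.2, weilMellin_const_mul, weilMellin_const_mul]
  set hh : ℝ → (ℝ → ℂ) := fun η ↦ weilDilate η (F η) with hhh
  -- (ii) for η > 0 the corrected dilate is an admissible pole-free test function in the OPEN window
  have hadm : ∀ η : ℝ, 0 < η → 0 ≤ (weilQuadratic (hh η)).re := by
    intro η hη
    have hη' : (-1 : ℝ) < η := by linarith
    have hc : 0 < 1 + η := by linarith
    refine h (hh η) ((hFtest η).weilDilate hη') ?_ ?_ ?_
    · refine (tsupport_weilDilate_subset (F η) hη' (hFsupp η)).trans (Icc_subset_Ioo ?_ ?_)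
      · have : a / (1 + η) < a := by rw [div_lt_iff₀ hc]; nlinarith
        linarith
      · rw [div_lt_iff₀ hc]; nlinarith
    · simp only [hhh]
      rw [weilMellin_weilDilate (F η) hη', hFM]
      have := hCramer₀ η hη'
      simp only [hG₀, hP₀] at this
      rw [show (1 / 2 : ℂ) + (0 - 1 / 2) / ((1 + η : ℝ) : ℂ) = s₀ η from rfl]
      rw [← this]
      ring
    · simp only [hhh]
      rw [weilMellin_weilDilate (F η) hη', hFM]
      have := hCramer₁ η hη'
      simp only [hG₁, hP₁] at this
      rw [show (1 / 2 : ℂ) + (1 - 1 / 2) / ((1 + η : ℝ) : ℂ) = s₁ η from rfl]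
      rw [← this]
      ring
  -- (iii) at η = 0 the correction vanishes: c₁(0) = c₂(0) = 0, F 0 = g, hh 0 = g
  have hs₀0 : s₀ 0 = 0 := by simp only [hs₀]; push_cast; ring
  have hs₁0 : s₁ 0 = 1 := by simp only [hs₁]; push_cast; ring
  have hc₁0 : c₁ 0 = 0 := by
    simp only [hc₁, hG₀, hG₁, hs₀0, hs₁0, hg0, hg1, zero_mul, mul_zero, sub_zero, zero_div]
  have hc₂0 : c₂ 0 = 0 := by
    simp only [hc₂, hG₀, hG₁, hs₀0, hs₁0, hg0, hg1, zero_mul, mul_zero, sub_zero, zero_div]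
  have hF0 : F 0 = g := by
    funext t
    simp only [hF, hc₁0, hc₂0, Pi.add_apply, neg_zero, zero_mul, add_zero]
  have hh0 : hh 0 = g := by simp only [hhh, hF0, weilDilate_zero]
  -- continuity of the coefficients at η = 0
  have hcontM : ∀ (w : ℝ → ℂ), IsWeilTest w → ∀ j : Fin 2,
      ContinuousAt (fun η : ℝ ↦ weilMellin w (if j = 0 then s₀ η else s₁ η)) 0 := by
    intro w hw j
    fin_cases j
    · simpa [hs₀] using continuousAt_weilMellin_dilateArg hw 0
    · simpa [hs₁] using continuousAt_weilMellin_dilateArg hw 1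
  have hG₀c : ContinuousAt G₀ 0 := by simpa using hcontM g hg 0
  have hG₁c : ContinuousAt G₁ 0 := by simpa using hcontM g hg 1
  have hP₀c : ContinuousAt P₀ 0 := by simpa using hcontM φ hφ 0
  have hP₁c : ContinuousAt P₁ 0 := by simpa using hcontM φ hφ 1
  have hS₀c : ContinuousAt (fun η ↦ weilMellin ψ (s₀ η)) 0 := by simpa using hcontM ψ hψ 0
  have hS₁c : ContinuousAt (fun η ↦ weilMellin ψ (s₁ η)) 0 := by simpa using hcontM ψ hψ 1
  have hDc : ContinuousAt D 0 := (hP₀c.mul hS₁c).sub (hS₀c.mul hP₁c)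
  have hc₁c : ContinuousAt c₁ 0 := ((hG₀c.mul hS₁c).sub (hS₀c.mul hG₁c)).div hDc (hDne 0 (by norm_num))
  have hc₂c : ContinuousAt c₂ 0 := ((hP₀c.mul hG₁c).sub (hG₀c.mul hP₁c)).div hDc (hDne 0 (by norm_num))
  -- continuity of η ↦ Q(hh η) at 0, through the nine-pairing expansion
  set E : ℝ → ℂ := fun η ↦
      weilFunctional (weilConv (weilDilate η g) (weilReflect (weilDilate η g)))
      + conj (-c₁ η) * weilFunctional (weilConv (weilDilate η g) (weilReflect (weilDilate η φ)))
      + conj (-c₂ η) * weilFunctional (weilConv (weilDilate η g) (weilReflect (weilDilate η ψ)))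
      + (-c₁ η) * weilFunctional (weilConv (weilDilate η φ) (weilReflect (weilDilate η g)))
      + (-c₂ η) * weilFunctional (weilConv (weilDilate η ψ) (weilReflect (weilDilate η g)))
      + (-c₁ η) * conj (-c₁ η) * weilFunctional (weilConv (weilDilate η φ) (weilReflect (weilDilate η φ)))
      + (-c₁ η) * conj (-c₂ η) * weilFunctional (weilConv (weilDilate η φ) (weilReflect (weilDilate η ψ)))
      + (-c₂ η) * conj (-c₁ η) * weilFunctional (weilConv (weilDilate η ψ) (weilReflect (weilDilate η φ)))
      + (-c₂ η) * conj (-c₂ η) * weilFunctional (weilConv (weilDilate η ψ) (weilReflect (weilDilate η ψ)))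
    with hE
  have hQE : ∀ η : ℝ, -1 < η → weilQuadratic (hh η) = E η := by
    intro η hη
    simp only [hhh, hF, weilDilate_add, weilDilate_const_mul, hE]
    exact weilQuadratic_add_three (hg.weilDilate hη) (hφ.weilDilate hη) (hψ.weilDilate hη) _ _
  have hnc₁ : ContinuousAt (fun η ↦ -c₁ η) 0 := hc₁c.neg
  have hnc₂ : ContinuousAt (fun η ↦ -c₂ η) 0 := hc₂c.neg
  have hcj₁ : ContinuousAt (fun η ↦ conj (-c₁ η)) 0 := Complex.continuous_conj.continuousAt.comp hnc₁
  have hcj₂ : ContinuousAt (fun η ↦ conj (-c₂ η)) 0 := Complex.continuous_conj.continuousAt.comp hnc₂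
  have hEc : ContinuousAt E 0 := by
    simp only [hE]
    have pgg := continuousAt_pairing_weilDilate hg hg
    have pgφ := continuousAt_pairing_weilDilate hg hφ
    have pgψ := continuousAt_pairing_weilDilate hg hψ
    have pφg := continuousAt_pairing_weilDilate hφ hg
    have pψg := continuousAt_pairing_weilDilate hψ hg
    have pφφ := continuousAt_pairing_weilDilate hφ hφ
    have pφψ := continuousAt_pairing_weilDilate hφ hψ
    have pψφ := continuousAt_pairing_weilDilate hψ hφ
    have pψψ := continuousAt_pairing_weilDilate hψ hψ
    exact (((((((pgg.add (hcj₁.mul pgφ)).add (hcj₂.mul pgψ)).add (hnc₁.mul pφg)).add (hnc₂.mul pψg)).add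
      ((hnc₁.mul hcj₁).mul pφφ)).add ((hnc₁.mul hcj₂).mul pφψ)).add ((hnc₂.mul hcj₁).mul pψφ)).add
      ((hnc₂.mul hcj₂).mul pψψ)
  have hQc : ContinuousAt (fun η : ℝ ↦ (weilQuadratic (hh η)).re) 0 := by
    have heq : (fun η : ℝ ↦ weilQuadratic (hh η)) =ᶠ[𝓝 0] E := by
      filter_upwards [Ioi_mem_nhds (show (-1 : ℝ) < 0 by norm_num)] with η hη
      exact hQE η hη
    exact Complex.continuous_re.continuousAt.comp (hEc.congr heq.symm)
  -- conclude: Re Q(g) = lim_{η ↓ 0} Re Q(hh η) ≥ 0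
  have hlim : Tendsto (fun η : ℝ ↦ (weilQuadratic (hh η)).re) (𝓝[>] 0) (𝓝 ((weilQuadratic (hh 0)).re)) :=
    hQc.tendsto.mono_left nhdsWithin_le_nhds
  rw [hh0] at hlim
  exact ge_of_tendsto hlim (eventually_nhdsWithin_of_forall fun η (hη : 0 < η) ↦ hadm η hη)

/-- A compact support inside the OPEN window `(−a, a)` lies inside a strictly smaller CLOSED window `[−b, b]`, `0 < b < a`. [folklore] -/
theorem exists_lt_tsupport_subset_Icc (ha : 0 < a) (hg : IsWeilTest g) (hsupp : tsupport g ⊆ Ioo (-a) a) :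
    ∃ b : ℝ, 0 < b ∧ b < a ∧ tsupport g ⊆ Icc (-b) b := by
  rcases (tsupport g).eq_empty_or_nonempty with he | hne
  · exact ⟨a / 2, by linarith, by linarith, by rw [he]; exact empty_subset _⟩
  · obtain ⟨x₀, hx₀, hmax⟩ := hg.2.isCompact.exists_isMaxOn hne (continuous_abs.continuousOn)
    have hx₀a : |x₀| < a := abs_lt.2 (hsupp hx₀)
    refine ⟨max |x₀| (a / 2), by positivity, max_lt hx₀a (by linarith), fun x hx ↦ ?_⟩
    have h1 : |x| ≤ |x₀| := hmax hx
    have h2 : |x| ≤ max |x₀| (a / 2) := h1.trans (le_max_left _ _)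
    exact ⟨by linarith [neg_abs_le x, abs_le.1 h2 |>.1], (le_abs_self x).trans h2⟩

/-- **The pole-free positive windows form a CLOSED initial segment**: if pole-free positivity holds on every strictly smaller closed window
`[−b, b]`, `0 < b < a`, then it holds on `[−a, a]` — the exact pole-free analogue of the tree's `weilSemilocalPositivityOn_of_forall_lt`
(Yoshida's Lemma-7 step). [cite: Yoshida1992HermitianForms, Lemma 7 (p. 312) / Prop. 6 (p. 320), transposed to the pole-free class] -/
theorem poleFree_nonneg_of_forall_lt (ha : 0 < a)
    (h : ∀ b : ℝ, 0 < b → b < a → ∀ g : ℝ → ℂ, IsWeilTest g → tsupport g ⊆ Icc (-b) b →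
      weilMellin g 0 = 0 → weilMellin g 1 = 0 → 0 ≤ (weilQuadratic g).re) :
    ∀ g : ℝ → ℂ, IsWeilTest g → tsupport g ⊆ Icc (-a) a → weilMellin g 0 = 0 → weilMellin g 1 = 0 →
      0 ≤ (weilQuadratic g).re := by
  refine poleFree_nonneg_Icc_of_Ioo ha fun g hg hsupp h0 h1 ↦ ?_
  obtain ⟨b, hb, hba, hsb⟩ := exists_lt_tsupport_subset_Icc ha hg hsupp
  exact h b hb hba g hg hsb h0 h1

/-- **The open and the closed pole-free windows carry the same positivity statement** (`a > 0`). [this track] -/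
theorem poleFree_nonneg_Ioo_iff_Icc (ha : 0 < a) :
    (∀ g : ℝ → ℂ, IsWeilTest g → tsupport g ⊆ Ioo (-a) a → weilMellin g 0 = 0 → weilMellin g 1 = 0 →
      0 ≤ (weilQuadratic g).re) ↔
    ∀ g : ℝ → ℂ, IsWeilTest g → tsupport g ⊆ Icc (-a) a → weilMellin g 0 = 0 → weilMellin g 1 = 0 →
      0 ≤ (weilQuadratic g).re :=
  ⟨poleFree_nonneg_Icc_of_Ioo ha, fun h g hg hsupp h0 h1 ↦ h g hg (hsupp.trans Ioo_subset_Icc_self) h0 h1⟩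

/-- **Conj. 4.1's content at `q` IS Connes's property `P(q)`** (`2 ≤ q`): pole-free Weil positivity for test functions
supported in the OPEN interval `(q^{−1/2}, q^{1/2})` (Connes–Consani 2019/2021, Conj. 4.1) is equivalent to the same for
the CLOSED interval (Connes 2026 §4.1, tree `weilPropertyP q`). [cite: ConnesConsani2021ScalingHamiltonian, Conj. 4.1 (arXiv:1910.14368 p. 18); Connes2026Letter §4.1 p. 17] -/
theorem cc41_iff_weilPropertyP {q : ℕ} (hq : 2 ≤ q) :
    (∀ g : ℝ → ℂ, IsWeilTest g → tsupport g ⊆ Ioo (-(Real.log q / 2)) (Real.log q / 2) →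
      weilMellin g 0 = 0 → weilMellin g 1 = 0 → 0 ≤ (weilQuadratic g).re) ↔ weilPropertyP q := by
  have ha : 0 < Real.log q / 2 := by
    have : 0 < Real.log q := Real.log_pos (by exact_mod_cast (show 1 < q by omega))
    linarith
  rw [weilPropertyP_iff, poleFree_nonneg_Ioo_iff_Icc ha]

/-! ## §5  The printed S-local reading: on these windows the `{p < q}`-form IS Weil's form -/

/-- **Locality on the closed window of `q`**: for a test function supported in `[−(log q)/2, (log q)/2]` the semi-local form of
`S = {p < q}` (all powers of those primes; archimedean and polar terms kept) coincides with Weil's form — the printed «the semi-local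
framework with `S = {∞} ∪ {p | p < q}`» loses nothing on the support `(q^{−1/2}, q^{1/2})` (and even on its closure). [cite: ConnesConsani2021ScalingHamiltonian, Conj. 4.1 and Fact 3.2 (arXiv:1910.14368 pp. 14, 18); ConnesConsani2023 §2.1.2] -/
theorem weilSemilocalQuadratic_primesBelow_eq {q : ℕ} (hq : 1 ≤ q) (hg : IsWeilTest g)
    (hsupp : tsupport g ⊆ Icc (-(Real.log q / 2)) (Real.log q / 2)) :
    weilSemilocalQuadratic (Nat.primesBelow q) g = weilQuadratic g := by
  have hS : ∀ n ≤ q - 1, IsPrimePow n → n.primeFactors ⊆ Nat.primesBelow (q - 1 + 1) :=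
    fun n hn _ ↦ primeFactors_subset_primesBelow hn
  rw [Nat.sub_add_cancel hq] at hS
  have hcast : ((q - 1 : ℕ) : ℝ) + 1 = (q : ℝ) := by exact_mod_cast Nat.sub_add_cancel hq
  refine weilSemilocalQuadratic_eq_weilQuadratic_of_forall hg hS ?_
  rw [hcast]
  exact hsupp

/-- **Conj. 4.1 as printed (S-local form, open window, two vanishing conditions) ⟺ Connes's `P(q)`** (`2 ≤ q`): positivity of the
`{p < q}`-SEMI-LOCAL form on the pole-free test functions supported in the OPEN interval `(q^{−1/2}, q^{1/2})` is equivalent to Weil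
positivity (full form) on the pole-free test functions of the CLOSED window — by locality (`weilSemilocalQuadratic_primesBelow_eq`) and the
closedness of the pole-free positive windows (`cc41_iff_weilPropertyP`). [cite: ConnesConsani2021ScalingHamiltonian, Conj. 4.1 (arXiv:1910.14368 p. 18); Connes2026Letter §4.1 p. 17] -/
theorem semilocal_cc41_iff_weilPropertyP {q : ℕ} (hq : 2 ≤ q) :
    (∀ g : ℝ → ℂ, IsWeilTest g → tsupport g ⊆ Ioo (-(Real.log q / 2)) (Real.log q / 2) →
      weilMellin g 0 = 0 → weilMellin g 1 = 0 → 0 ≤ (weilSemilocalQuadratic (Nat.primesBelow q) g).re) ↔ weilPropertyP q := by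
  rw [← cc41_iff_weilPropertyP hq]
  refine forall₂_congr fun g hg ↦ forall_congr' fun hsupp ↦ ?_
  rw [weilSemilocalQuadratic_primesBelow_eq (by omega) hg (hsupp.trans Ioo_subset_Icc_self)]

end Summit.RiemannHypothesis.RiemannHypothesis.Theorems.HandoffPoleFree
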